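import Summits.KontsevichZagierPeriods.KontsevichZagierPeriods.Theorems.SoloInformedToricLinearPart
import HarnessLib

/-!
# The `ζ(n)` denominators `1 − ∏ᵢ (1 − xᵢ)` are cube-nondegenerate

Solo programme `solo-KontsevichZagierPeriods-informed`, session s104.

The period `ζ(n) = ∫_{[0,1]ⁿ} dx₁ ⋯ dxₙ / (1 − x₁ ⋯ xₙ)` [Kontsevich–Zagier 2001, §1.1] becomes, after
the corner move `xᵢ ↦ 1 − xᵢ` (an affine change of variables of the calculus), the cube integral of
`1/Qₙ` with `Qₙ := 1 − ∏ᵢ (1 − xᵢ) ∈ ℚ[x₁, …, xₙ]`, which vanishes at the corner `0`.  Here: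

* `soloInformed_cubeNondegenerate_zetaDenominator` — `Qₙ` is cube-nondegenerate for every
  `n ≥ 1` (LEMMA LIN: `Qₙ(0) = 0`, all linear coefficients equal `1`, and
  `Qₙ > 0` on `[0,1]ⁿ ∖ {0}`);
* `soloInformed_presentable_zetaDenominator` — hence, by THEOREM ND, every `IntegralRep`
  `[[0,1]ⁿ, x^p/Qₙ(x)]` is presentable by cube integrals of germs holomorphic near the closed cube,
  inside the KZ calculus: the toric resolution of the `ζ(n)` integrals is carried out by the moves.

References: M. Kontsevich, D. Zagier, *Periods* (2001), §1.1; J. Ayoub, EMS Newsl. 91 (2014),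
§2.2; A. G. Kouchnirenko, Invent. Math. 32 (1976) §1.
-/

noncomputable section

open scoped BigOperators
open MeasureTheory Set
open Literature.NumberTheory.Transcendental Literature.NumberTheory.Transcendental.KZ

namespace Summit.KontsevichZagierPeriods.KontsevichZagierPeriods.Theorems

variable {n : ℕ}

/-- The `ζ(n)` denominator after the corner move: `Qₙ = 1 − ∏ᵢ (1 − Xᵢ)`. [Kontsevich–Zagier 2001,
§1.1] -/
def soloInformedZetaDenominator (n : ℕ) : MvPolynomial (Fin n) ℚ :=
  1 - ∏ j, (1 - MvPolynomial.X j)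

/-- `∏_{j ∈ s} (1 − Xⱼ)` has constant term `1`. [this work] -/
theorem soloInformed_constantCoeff_prod_one_sub_X (s : Finset (Fin n)) :
    MvPolynomial.constantCoeff (∏ j ∈ s, (1 - MvPolynomial.X j : MvPolynomial (Fin n) ℚ)) = 1 := by
  rw [map_prod]
  exact Finset.prod_eq_one fun j _ => by simp [MvPolynomial.constantCoeff_X]

/-- The variable `Xᵢ` does not occur in `∏_{j ≠ i} (1 − Xⱼ)`. [this work] -/
theorem soloInformed_not_mem_vars_prod_one_sub_X (i : Fin n) :
    i ∉ MvPolynomial.vars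
      (∏ j ∈ Finset.univ.erase i, (1 - MvPolynomial.X j : MvPolynomial (Fin n) ℚ)) := by
  classical
  intro h
  obtain ⟨j, hj, hij⟩ := Finset.mem_biUnion.1
    (MvPolynomial.vars_prod (fun j => (1 - MvPolynomial.X j : MvPolynomial (Fin n) ℚ)) h)
  have h2 := MvPolynomial.vars_sub_subset (p := (1 : MvPolynomial (Fin n) ℚ))
    (q := MvPolynomial.X j) hij
  rw [MvPolynomial.vars_one, MvPolynomial.vars_X, Finset.empty_union, Finset.mem_singleton] at h2
  exact (Finset.ne_of_mem_erase hj) h2.symm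

/-- The linear coefficients of `∏ⱼ (1 − Xⱼ)` are `−1`. [this work] -/
theorem soloInformed_coeff_single_prod_one_sub_X (i : Fin n) :
    MvPolynomial.coeff (Finsupp.single i 1)
      (∏ j, (1 - MvPolynomial.X j : MvPolynomial (Fin n) ℚ)) = -1 := by
  classical
  set R' : MvPolynomial (Fin n) ℚ := ∏ j ∈ Finset.univ.erase i, (1 - MvPolynomial.X j) with hR'
  rw [← Finset.mul_prod_erase Finset.univ (fun j => (1 - MvPolynomial.X j : MvPolynomial (Fin n) ℚ))
    (Finset.mem_univ i)]
  rw [← hR', sub_mul, one_mul, MvPolynomial.coeff_sub, MvPolynomial.coeff_X_mul']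
  -- `coeff_{e_i} R' = 0` since `X_i` does not occur in `R'`
  have h1 : MvPolynomial.coeff (Finsupp.single i 1) R' = 0 := by
    by_contra hne
    refine soloInformed_not_mem_vars_prod_one_sub_X i ?_
    rw [← hR', MvPolynomial.mem_vars_iff_mem_support]
    exact ⟨Finsupp.single i 1, MvPolynomial.mem_support_iff.2 hne, by simp⟩
  -- `coeff_0 R' = 1`
  have h2 : MvPolynomial.coeff (Finsupp.single i 1 - Finsupp.single i 1) R' = 1 := by
    rw [tsub_self, ← MvPolynomial.constantCoeff_eq, hR']
    exact soloInformed_constantCoeff_prod_one_sub_X _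
  rw [h1, if_pos (by simp), h2]
  norm_num

/-- `Qₙ(0) = 0`. [this work] -/
theorem soloInformed_coeff_zero_zetaDenominator (n : ℕ) :
    MvPolynomial.coeff 0 (soloInformedZetaDenominator n) = 0 := by
  unfold soloInformedZetaDenominator
  rw [MvPolynomial.coeff_sub, MvPolynomial.coeff_zero_one, ← MvPolynomial.constantCoeff_eq]
  show (1 : ℚ) - MvPolynomial.constantCoeff _ = 0
  rw [soloInformed_constantCoeff_prod_one_sub_X, sub_self]

/-- The linear coefficients of `Qₙ` are `1`. [this work] -/
theorem soloInformed_coeff_single_zetaDenominator (i : Fin n) :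
    MvPolynomial.coeff (Finsupp.single i 1) (soloInformedZetaDenominator n) = 1 := by
  classical
  unfold soloInformedZetaDenominator
  have h0 : (0 : Fin n →₀ ℕ) ≠ Finsupp.single i 1 := fun h => by
    have h1 := Finsupp.ext_iff.1 h i
    simp at h1
  rw [MvPolynomial.coeff_sub, MvPolynomial.coeff_one, if_neg h0,
    soloInformed_coeff_single_prod_one_sub_X]
  norm_num

/-- `Qₙ(x) = 1 − ∏ᵢ (1 − xᵢ)`. [this work] -/
theorem soloInformed_aeval_zetaDenominator (x : Fin n → ℝ) :
    MvPolynomial.aeval x (soloInformedZetaDenominator n) = 1 - ∏ j, (1 - x j) := by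
  unfold soloInformedZetaDenominator
  simp only [map_sub, map_one, map_prod, MvPolynomial.aeval_X]

/-- `Qₙ > 0` on the punctured closed cube: `∏ᵢ (1 − xᵢ) ≤ 1 − xᵢ₀ < 1` if `xᵢ₀ > 0`. [this work] -/
theorem soloInformed_aeval_zetaDenominator_pos {x : Fin n → ℝ} (hx : ∀ i, 0 ≤ x i ∧ x i ≤ 1)
    (hx0 : x ≠ 0) : 0 < MvPolynomial.aeval x (soloInformedZetaDenominator n) := by
  classical
  rw [soloInformed_aeval_zetaDenominator, sub_pos]
  obtain ⟨i, hi⟩ := Function.ne_iff.1 hx0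
  have hi' : 0 < x i := lt_of_le_of_ne (hx i).1 (Ne.symm hi)
  rw [← Finset.mul_prod_erase Finset.univ (fun j => 1 - x j) (Finset.mem_univ i)]
  have h1 : ∏ j ∈ Finset.univ.erase i, (1 - x j) ≤ 1 :=
    Finset.prod_le_one (fun j _ => sub_nonneg.2 (hx j).2) fun j _ => sub_le_self _ (hx j).1
  have h2 : 0 ≤ ∏ j ∈ Finset.univ.erase i, (1 - x j) :=
    Finset.prod_nonneg fun j _ => sub_nonneg.2 (hx j).2
  calc (1 - x i) * ∏ j ∈ Finset.univ.erase i, (1 - x j) ≤ (1 - x i) * 1 :=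
        mul_le_mul_of_nonneg_left h1 (sub_nonneg.2 (hx i).2)
    _ < 1 := by linarith

/-- **The `ζ(n)` denominators are cube-nondegenerate** (`n ≥ 1`). [this work] -/
theorem soloInformed_cubeNondegenerate_zetaDenominator (hn : 0 < n) :
    SoloInformedCubeNondegenerate (soloInformedZetaDenominator n) :=
  soloInformed_cubeNondegenerate_of_linear hn _ (soloInformed_coeff_zero_zetaDenominator n)
    (fun i => by rw [soloInformed_coeff_single_zetaDenominator i]; exact one_pos)
    fun _ hx hx0 => (soloInformed_aeval_zetaDenominator_pos hx hx0).ne'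

/-- **Presentation of the `ζ(n)` integrals**: every `IntegralRep` on `[0,1]ⁿ` (`n ≥ 1`) whose
integrand is `x^p / (1 − ∏ᵢ (1 − xᵢ))` on the open cube — for `p = 0` the corner-moved
`ζ(n) = ∫_{[0,1]ⁿ} dx/(1 − x₁⋯xₙ)` — is presentable by cube integrals of germs holomorphic near
the closed cube, inside the KZ calculus (THEOREM ND; THEOREM TOR does not apply). [this work] -/
theorem soloInformed_presentable_zetaDenominator (hn : 0 < n) (p : Fin n → ℕ) (r : IntegralRep n)
    (hr : r.domain = soloInformedCube n)
    (hri : EqOn r.integrand (fun x => (∏ j, x j ^ p j) / (1 - ∏ j, (1 - x j)))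
      (soloInformedOpenCube n)) :
    of r ∈ soloInformedPresentable :=
  soloInformed_presentable_of_nondegenerate p _ (soloInformed_cubeNondegenerate_zetaDenominator hn)
    r hr fun x hx => by simp only [hri hx, soloInformed_aeval_zetaDenominator]

end Summit.KontsevichZagierPeriods.KontsevichZagierPeriods.Theorems
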